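import Summits.Ventures.AbcSig.Rows.XTemplateC2c
import Summits.Ventures.AbcSig.Levels.N12032

/-!
# Venture AbcSig — C2c ROW `C2cL47`: `A xⁿ + B yⁿ = 2 z²`, `A·B = 47^m` over the NORM-FORM level 12032 = 2⁸·47 (GENERATED by p-lean g4 `gen4/c2crow.py`)

HONEST FRAMING. A row of a COMPUTATION cell (`pub-abcsig`); a CONDITIONAL theorem, no claim on ABC or any summit.
Hypotheses: `BS04Package` (CITED); `DataComplete 12032` + `RefinesCPSymAll 12032` (COMPUTED: certified engine-1 level file, norm-form
certificates `Sieve/CharpolyCert.lean`); the listed per-orbit exclusions `hX_…` (CITED: the row of record's module closures, nothing of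
them checked here). Template `Rows/XTemplateC2c.lean` (case (ii)_C, level 2⁸·ℓ). Exponent range: prime `n ≥ 11`, `n ≠ 47`;
`1 ≤ m < n` — the REDUCED exponent range (RULING H1); p1's census predicate `Rows.C2cCell` is stated for `n ∤ m` (unreduced), so no
cell bridge is given here (the reduction m ↦ m mod n, y ↦ ℓ^q·y is routine but not formalised in this file).
Residual of record: none. No cited exclusion: every (orbit, exponent ≥ 11) pair is killed in the kernel.
Row of record: `census/rows/C2a/C2c-l47.md` (sha16 `74b5b7717a7ef432`; SIGNED 2026-08-22T16:56:39Z by referee (ref-g12)).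
-/

namespace Summit.Ventures.AbcSig

/-- C2c row `C2cL47`, first distribution `xⁿ + 47^m·yⁿ = 2z²` (`B` written `2⁰·47^m`); prime `n ≥ 11`, `n ≠ 47`. -/
theorem xrow_C2cL47 (M : NewformModel) (hP : M.BS04Package)
    (hD12032 : M.DataComplete 12032 level12032Orbits) (hCP12032 : M.RefinesCPSymAll 12032 level12032CP)
    (n : ℕ) (hn : n.Prime) (hmin : 11 ≤ n) (hnℓ : n ≠ 47) (m : ℕ) (hm : 1 ≤ m) (hmn : m < n)
    (x y z : ℤ) (hxy1 : x * y ≠ 1) (hxy2 : x * y ≠ -1) : ¬ IsPrimitiveSolution 1 (2 ^ 0 * 47 ^ m) 2 n x y z := by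
  have hℓ : Nat.Prime 47 := by norm_num
  have h7 : 7 ≤ n := by omega
  exact xrow_template_C2c 47 hℓ (by norm_num) M hP hD12032 n hn h7 hnℓ m hm hmn
    (level12032_sieve M hP hCP12032 n hn h7 (fun o => M.Excludes 12032 o (famC2c 47 m n) ∨ M.ExcludesStd 12032 o n) (fun _ h => Or.inr h) (fun hmem => by
      obtain rfl : n = 7 := by simpa using hmem
      omega) (fun hmem => by
      obtain rfl : n = 7 := by simpa using hmem
      omega))
    x y z hxy1 hxy2

/-- C2c row `C2cL47`, second distribution `47^m·xⁿ + yⁿ = 2z²` (by `IsPrimitiveSolution.swap`). -/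
theorem xrow_C2cL47_swap (M : NewformModel) (hP : M.BS04Package)
    (hD12032 : M.DataComplete 12032 level12032Orbits) (hCP12032 : M.RefinesCPSymAll 12032 level12032CP)
    (n : ℕ) (hn : n.Prime) (hmin : 11 ≤ n) (hnℓ : n ≠ 47) (m : ℕ) (hm : 1 ≤ m) (hmn : m < n)
    (x y z : ℤ) (hxy1 : x * y ≠ 1) (hxy2 : x * y ≠ -1) : ¬ IsPrimitiveSolution (2 ^ 0 * 47 ^ m) 1 2 n x y z := by
  intro h
  exact xrow_C2cL47 M hP hD12032 hCP12032 n hn hmin hnℓ m hm hmn  y x z (by rwa [mul_comm]) (by rwa [mul_comm]) h.swap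

end Summit.Ventures.AbcSig
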